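import Summits.Ventures.HSemireg.WedgeHankelRecurrenceSecantDeterminant
import Summits.Ventures.HSemireg.WedgeHankelRecurrenceSymbol

/-!
# Venture HSemireg — THE POWER SUMS ARE THE DUAL CLASS OF THE DERIVATIVE (Newton ∕ partial fractions `m′/m = Σ_i 1/(X − λ_i)`): for any nodes `λ_0, …, λ_{r−1}` (repetitions allowed) and
# `m = ∏_i (X − λ_i)`, **`dualSeq m m′ = (Σ_i λ_i^j)_j`**, the sequence of POWER SUMS; hence, for `t + 1` nodes, **`det (p_{i+j})_{i,j ≤ t} = ∏_{i<j} (λ_j − λ_i)²`** — the discriminant of `m`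
# as the Hankel determinant of the power sums of its roots (Sylvester ∕ Borchardt), non-zero iff the nodes are distinct

HONEST FRAMING. Part of the Lean index of the computation cell `pub-hsemireg` (seat p10 gen 30, Sunday typer «UNIFORM-IN-n»).
LINEAR ALGEBRA OF HANKEL (catalecticant) MATRICES and of polynomials over a field ONLY (`Polynomial.modByMonic`, `Polynomial.derivative`): no variety, no cohomology theory, no sheaf, no
Ext group and no semiregularity map is constructed here; nothing here says that HC / HC_CM / HC_AV holds; no Literature fact is declared or used.  Custodian versions as in
`WedgeHankelSiegelIdeal` (1/3); the dictionary («Newton's power sums `p_j = Σ λ_i^j` are the Laurent coefficients of `m′/m` at `∞`; `disc(m) = det (p_{i+j})`», Borchardt 1847 ∕ Sylvester) is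
QUOTED in docstrings, never asserted.

WHAT IS IN THE TREE / CHAINED.  N45 (`WedgeHankelRecurrenceSymbol`, № 327): `dualSeq_add_dualSeq` (`dualSeq m a + dualSeq m′ a′ = dualSeq (m m′) (a m′ + a′ m)`); N32 (№ 263) `dualSeq`, `dualSeq_apply`,
`dualSeq_smul`; `WedgeHankelSecantRank` (tree): `secSeq`, `secSeq_snoc`, `secSeq_zero`; N78 (`WedgeHankelRecurrenceSecantDeterminant`): `det_hankelSq_secSeq_eq_prod`, `det_hankelSq_secSeq_ne_zero_iff`.
Mathlib: `Polynomial.modByMonic_X_sub_C_eq_C_eval`, `Polynomial.derivative_mul`, `derivative_X_sub_C`, `Fin.prod_univ_castSucc`, `Fin.snoc`.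
THIS FILE (namespace `Summit.Ventures.HSemireg.Wedge.HankelOuter` continued; CHAINED on N78 (N45 in the tree); 0 definitions):
* §637 `dualSeq_X_sub_C_one` (`dualSeq (X − c) 1 = (c^j)_j`, the geometric class), `dualSeq_one_zero`, **`dualSeq_prod_X_sub_C_derivative`** (`dualSeq (∏ (X − λ_i)) (∏ (X − λ_i))′ = secSeq 1 λ`:
  THE POWER SUMS, any nodes), **`det_hankelSq_powerSums`** (`t + 1` nodes: `det (p_{i+j})_{i,j ≤ t} = (∏_i ∏_{j>i} (λ_j − λ_i))²`), `det_hankelSq_powerSums_ne_zero_iff` (`↔ λ` injective).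
Nothing Ext-side.  New names only.
-/

open Module Polynomial
open scoped Matrix Polynomial

namespace Summit.Ventures.HSemireg.Wedge.HankelOuter

open Summit.Ventures.HSemireg.Wedge Summit.Ventures.HSemireg.Wedge.Hankel Summit.Ventures.HSemireg.Wedge.HankelSecant

variable (K : Type*) [Field K]

/-! ## §637. `m′/m = Σ 1/(X − λ_i)`: the power sums as a dual class, and their Hankel determinant -/

/-- **`dualSeq (X − c) 1 = (c^j)_j`**: the dual class of `1` modulo `X − c` is the geometric class of ratio `c` (`X^j mod (X − c) = c^j`). -/
theorem dualSeq_X_sub_C_one (c : K) : dualSeq K (Polynomial.X - C c) 1 = fun j => c ^ j := by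
  funext j
  rw [dualSeq_apply, mul_one, Polynomial.modByMonic_X_sub_C_eq_C_eval, Polynomial.natDegree_X_sub_C, Nat.sub_self, Polynomial.coeff_C_zero, Polynomial.eval_pow, Polynomial.eval_X]

/-- `dualSeq 1 0 = 0` (no node). -/
theorem dualSeq_one_zero : dualSeq K (1 : K[X]) 0 = 0 := by
  rw [← zero_smul K (1 : K[X]), dualSeq_smul, zero_smul]

/-- **THE POWER SUMS ARE THE DUAL CLASS OF THE DERIVATIVE: `dualSeq (∏_i (X − λ_i)) (∏_i (X − λ_i))′ = (Σ_i λ_i^j)_j`** for ANY nodes `λ : Fin r → K` (repetitions allowed) — the partial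
fraction expansion `m′/m = Σ_i 1/(X − λ_i)` (induction on `r`: `(m·(X − c))′ = m′·(X − c) + 1·m` and N45's addition of symbols). -/
theorem dualSeq_prod_X_sub_C_derivative {r : ℕ} (lam : Fin r → K) :
    dualSeq K (∏ i, (Polynomial.X - C (lam i))) (derivative (∏ i, (Polynomial.X - C (lam i)))) = secSeq K (fun _ => (1 : K)) lam := by
  induction r with
  | zero =>
    rw [Fintype.prod_empty, Polynomial.derivative_one, dualSeq_one_zero, secSeq_zero]
  | succ r ih =>
    have hsplit : (∏ i : Fin (r + 1), (Polynomial.X - C (lam i))) = (∏ i : Fin r, (Polynomial.X - C (lam (Fin.castSucc i)))) * (Polynomial.X - C (lam (Fin.last r))) :=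
      Fin.prod_univ_castSucc _
    have hm : (∏ i : Fin r, (Polynomial.X - C (lam (Fin.castSucc i)))).Monic := Polynomial.monic_prod_of_monic _ _ fun i _ => Polynomial.monic_X_sub_C _
    rw [hsplit, Polynomial.derivative_mul, Polynomial.derivative_X_sub_C, mul_one,
      show derivative (∏ i : Fin r, (Polynomial.X - C (lam (Fin.castSucc i)))) * (Polynomial.X - C (lam (Fin.last r))) + (∏ i : Fin r, (Polynomial.X - C (lam (Fin.castSucc i))))
        = derivative (∏ i : Fin r, (Polynomial.X - C (lam (Fin.castSucc i)))) * (Polynomial.X - C (lam (Fin.last r))) + 1 * (∏ i : Fin r, (Polynomial.X - C (lam (Fin.castSucc i)))) by rw [one_mul],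
      ← dualSeq_add_dualSeq K hm (Polynomial.monic_X_sub_C _), ih (fun i => lam (Fin.castSucc i)), dualSeq_X_sub_C_one]
    have hl : lam = Fin.snoc (fun i => lam (Fin.castSucc i)) (lam (Fin.last r)) := by
      funext i; refine Fin.lastCases ?_ (fun j => ?_) i
      · rw [Fin.snoc_last]
      · rw [Fin.snoc_castSucc]
    have h1 : (fun _ : Fin (r + 1) => (1 : K)) = Fin.snoc (fun _ : Fin r => (1 : K)) 1 := by
      funext i; refine Fin.lastCases ?_ (fun j => ?_) i
      · rw [Fin.snoc_last]
      · rw [Fin.snoc_castSucc]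
    conv_rhs => rw [hl, h1, secSeq_snoc]
    simp only [one_mul]

/-- **THE DISCRIMINANT AS A HANKEL DETERMINANT (Borchardt ∕ Sylvester): for `t + 1` nodes and `m = ∏ (X − λ_i)`, `det (dualSeq m m′ (i + j))_{i,j ≤ t} = (∏_i ∏_{j>i} (λ_j − λ_i))²`** — the
Hankel matrix of the power sums `p_0, …, p_{2t}` has determinant the square of the Vandermonde (N78 with unit weights). -/
theorem det_hankelSq_powerSums {t : ℕ} (lam : Fin (t + 1) → K) :
    (hankelSq K t (dualSeq K (∏ i, (Polynomial.X - C (lam i))) (derivative (∏ i, (Polynomial.X - C (lam i)))))).det = (∏ i : Fin (t + 1), ∏ j ∈ Finset.Ioi i, (lam j - lam i)) ^ 2 := by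
  rw [dualSeq_prod_X_sub_C_derivative, det_hankelSq_secSeq_eq_prod, Finset.prod_const_one, one_mul]

/-- **… non-zero iff the nodes are distinct** (`m` separable). -/
theorem det_hankelSq_powerSums_ne_zero_iff {t : ℕ} (lam : Fin (t + 1) → K) :
    (hankelSq K t (dualSeq K (∏ i, (Polynomial.X - C (lam i))) (derivative (∏ i, (Polynomial.X - C (lam i)))))).det ≠ 0 ↔ Function.Injective lam := by
  rw [dualSeq_prod_X_sub_C_derivative, det_hankelSq_secSeq_ne_zero_iff]
  exact ⟨fun h => h.2, fun h => ⟨fun _ => one_ne_zero, h⟩⟩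

end Summit.Ventures.HSemireg.Wedge.HankelOuter
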